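import Summits.CriticalPhenomena.PercolationContinuityZ3.Theorems.Transplant.FKConnectivityAllQForestTransversal
import Summits.CriticalPhenomena.PercolationContinuityZ3.Theorems.Transplant.FKConnectivityAllQForestDetourTriangle
import HarnessLib

/-!
# The PATTERN DEFECT `D`: the node (♣)⁰ as one of three upper bounds on a fully symmetric 3-terminal count, and the new lower bound F3

Support file (`--supports stmt-CriticalPhenomena-4575`), FK sub-lane `prim-bschramm-fk-1` (generation 33) of the post-continuity
programme; builds on p205010 (kernel theorem, internal audit signed; external expert review pending).  Two counting nodes (NOT asserted)
with their `Pos` forms, theorems otherwise; no named facts, no sorries; standard axioms.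

SETTING.  Ordered two-forest colourings `(ω, ω ∆ M)` of a fibre `(M, u₀)` counted by `fibreCount`, as everywhere in this directory.  For three
vertices `o, v, y` every colouring class has one of five PATTERNS: `0` (no two of `o,v,y` joined), `OV` (`o ~ v` only), `OY`, `VY`, `OVY`
(all joined) — the events `patt0 … pattOVY` below; write `N(α;β) := #(Fo ∩ α, Fo ∩ β)` (first class of pattern `α`, second of pattern `β`;
`N(α;β) = N(β;α)` by the involution `fibreCount_swap`).  On the REST fibre (the pairs `e = ov`, `f = oy` peeled off, g32 `…ForestTransversal`)
the node (♣)⁰ reads `badR ≤ goodR` with `badR = N(0; all) = #(Fo ∩ patt0, Fo)`, `goodR = #(Fo ∩ {o ≁ v}, Fo ∩ {o ≁ y})`.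

**THE DEFECT.**  `D := N(0;OVY) − N(OV;OY) − N(OV;VY) − N(OY;VY)` is invariant under all permutations of `(o,v,y)` and under the swap of the two
classes.  **IDENTITY (`forest_pattern_identity`, proved): `goodR + N(0;OVY) = badR + N(OV;OY) + N(OV;VY) + N(OY;VY) + N(VY;0) + N(VY;VY)`**, i.e.
`goodR − badR = N(0;VY) + N(VY;VY) − D`.  Hence (all proved here):
* the node on the rest fibre ⟺ **`D ≤ N(0;VY) + N(VY;VY)`** (`forest_rest_node_iff_defectBound`); the D-form node `ForestDefectBoundOn V` (NOT asserted)
  implies `AdjForestRayleighNoSqOn V` (`adjForestRayleighNoSqOn_of_defectBound`, via g32's peeling injections);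
* Cibulka–Hladký–LaCroix–Wagner's with-square form is `D ≤ N(0;VY)` (false from 9 vertices on, g16/g17), and by the symmetry of `D` the node for the three
  choices of the special vertex is the family of upper bounds `D ≤ N(0;P) + N(P;P)`, `P ∈ {OV, OY, VY}`;
* **NEW NODE F3 `ForestThreePointOn V` (NOT asserted): `D ≥ 0`, i.e. `N(OV;OY) + N(OV;VY) + N(OY;VY) ≤ N(0;OVY)`** — equivalently an UPPER bound
  for the node's margin: **F3 ⟹ `goodR ≤ badR + N(VY;0) + N(VY;VY)`** (`forest_rest_margin_le_of_threePoint`).  At tree level `D = 0` is Jacobi's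
  all-minors identity `F_{o|v|y}·T = F_{ov|y}F_{oy|v} + F_{ov|y}F_{vy|o} + F_{oy|v}F_{vy|o}` (CHLW's theorem, adjacent case, is its coefficient extraction).
EVIDENCE (memo bschramm/FROM-fk-1-g33-PATTERN-CONE.md; engines cone3.c / ftest.c / conelib.py of the seat, exact): F3 has 0 failures on every graph with ≤ 9
vertices (all 1,245,649 symmetrised pattern directions of top fibres, every (o,v,y)), in 3,881,433 random instances with 9–14 vertices (tight in ≈ 77 %)
and on 792 random multigraphs with ≤ 7 vertices (= fibres with pinned pairs; 0 failures, 773 tight); the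
conic hull of ALL pattern vectors of graphs with ≤ 8 vertices (164,142 directions in ℝ¹⁵) is SIMPLICIAL with facets = 11 coordinates + `D ≥ 0` + the three
with-square forms — so every universal linear inequality among the pattern counts visible through 8 vertices is a bound on `D`.
[cite: CibulkaHladkyLaCroixWagner2008, Thm. 1 (p. 2)] [cite: SempleWelsh2008, Conj. 1.1 (p. 2); Thm. 4.2 (p. 11)] [cite: Linusson2011, Prop. 2.6]
[cite: Grimmett2006, §1.5 (p. 13)]
-/

noncomputable section

namespace Summit.CriticalPhenomena.PercolationContinuityZ3.Theorems
namespace FK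

open Set Literature.Probability.LatticeModels Literature.Probability.Percolation
open scoped Classical symmDiff

variable {V : Type*} [Fintype V]

/-! ### The five patterns of three terminals -/

/-- Pattern `0`: no two of `o, v, y` are joined. [cite: Grimmett2006, §1.5 (p. 13)] -/
def patt0 (o v y : V) : Set (BondConfig V) := (reachEv o v)ᶜ ∩ (reachEv o y)ᶜ ∩ (reachEv v y)ᶜ
/-- Pattern `OV`: `o ~ v`, `o ≁ y` (hence `v ≁ y`). [cite: Grimmett2006, §1.5 (p. 13)] -/
def pattOV (o v y : V) : Set (BondConfig V) := reachEv o v ∩ (reachEv o y)ᶜ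
/-- Pattern `OY`: `o ≁ v`, `o ~ y` (hence `v ≁ y`). [cite: Grimmett2006, §1.5 (p. 13)] -/
def pattOY (o v y : V) : Set (BondConfig V) := (reachEv o v)ᶜ ∩ reachEv o y
/-- Pattern `VY`: `o ≁ v`, `o ≁ y`, `v ~ y`. [cite: Grimmett2006, §1.5 (p. 13)] -/
def pattVY (o v y : V) : Set (BondConfig V) := (reachEv o v)ᶜ ∩ (reachEv o y)ᶜ ∩ reachEv v y
/-- Pattern `OVY`: `o ~ v` and `o ~ y` (all three joined). [cite: Grimmett2006, §1.5 (p. 13)] -/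
def pattOVY (o v y : V) : Set (BondConfig V) := reachEv o v ∩ reachEv o y

/-! ### The nodes -/

/-- **NODE F3 — the three-point lower bound `D ≥ 0` on the vertex type `V`** (conjecture-shaped, NOT asserted): for every fibre `(M, u₀)` and all
`o, v, y`: `N(OV;OY) + N(OV;VY) + N(OY;VY) ≤ N(0;OVY)` — the colourings whose two classes join two DIFFERENT pairs are at most as many as those whose
first class separates `o, v, y` pairwise while the second joins all three.  Fully symmetric in `(o,v,y)` and under the class swap.
[cite: CibulkaHladkyLaCroixWagner2008, Thm. 1 (p. 2)] [cite: Linusson2011, Prop. 2.6] -/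
def ForestThreePointOn (V : Type*) [Fintype V] : Prop :=
  ∀ (M u₀ : BondConfig V), Disjoint u₀ M → ∀ (o v y : V),
    fibreCount M u₀ (forestEv V ∩ pattOV o v y) (forestEv V ∩ pattOY o v y) +
        fibreCount M u₀ (forestEv V ∩ pattOV o v y) (forestEv V ∩ pattVY o v y) +
          fibreCount M u₀ (forestEv V ∩ pattOY o v y) (forestEv V ∩ pattVY o v y) ≤
      fibreCount M u₀ (forestEv V ∩ patt0 o v y) (forestEv V ∩ pattOVY o v y)

/-- **F3 on every finite vertex type.**  CONJECTURE-SHAPED, NOT asserted (evidence in the module docstring).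
[cite: CibulkaHladkyLaCroixWagner2008, Thm. 1 (p. 2)] [cite: SempleWelsh2008, Conj. 1.1 (p. 2)] -/
@[conjecture] def ForestThreePointPos : Prop := ∀ n : ℕ, ForestThreePointOn (Fin n)

/-- **NODE (♣)⁰ IN DEFECT FORM on the vertex type `V`** (conjecture-shaped, NOT asserted): for every fibre and all pairwise distinct `o, v, y`:
`N(0;OVY) ≤ N(OV;OY) + N(OV;VY) + N(OY;VY) + N(VY;0) + N(VY;VY)`, i.e. `D ≤ N(0;VY) + N(VY;VY)`; equivalent on each rest fibre to `badR ≤ goodR`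
(`forest_rest_node_iff_defectBound`) and sufficient for `AdjForestRayleighNoSqOn V` (`adjForestRayleighNoSqOn_of_defectBound`).
[cite: SempleWelsh2008, Conj. 1.1 (p. 2)] [cite: Linusson2011, Prop. 2.6] -/
def ForestDefectBoundOn (V : Type*) [Fintype V] : Prop :=
  ∀ (M u₀ : BondConfig V), Disjoint u₀ M → ∀ (o v y : V), o ≠ v → o ≠ y → v ≠ y →
    fibreCount M u₀ (forestEv V ∩ patt0 o v y) (forestEv V ∩ pattOVY o v y) ≤
      fibreCount M u₀ (forestEv V ∩ pattOV o v y) (forestEv V ∩ pattOY o v y) +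
        fibreCount M u₀ (forestEv V ∩ pattOV o v y) (forestEv V ∩ pattVY o v y) +
          fibreCount M u₀ (forestEv V ∩ pattOY o v y) (forestEv V ∩ pattVY o v y) +
            fibreCount M u₀ (forestEv V ∩ pattVY o v y) (forestEv V ∩ patt0 o v y) +
              fibreCount M u₀ (forestEv V ∩ pattVY o v y) (forestEv V ∩ pattVY o v y)

/-- **The defect form of (♣)⁰ on every finite vertex type.**  CONJECTURE-SHAPED, NOT asserted (it is (♣)⁰ = `AdjForestRayleighNoSqPos` rewritten).
[cite: SempleWelsh2008, Conj. 1.1 (p. 2); Thm. 4.2 (p. 11)] -/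
@[conjecture] def ForestDefectBoundPos : Prop := ∀ n : ℕ, ForestDefectBoundOn (Fin n)

/-! ### The pattern identity `goodR + N(0;OVY) = badR + crossings + N(VY;0) + N(VY;VY)` -/

section Identity

variable (M u₀ : BondConfig V) (o v y : V)

/-- `goodR` split by the patterns of both classes (3 × 3 terms). [cite: Linusson2011, Prop. 2.6] -/
theorem forest_rest_good_eq :
    fibreCount M u₀ (forestEv V ∩ (reachEv o v)ᶜ) (forestEv V ∩ (reachEv o y)ᶜ) =
      fibreCount M u₀ (forestEv V ∩ pattOY o v y) (forestEv V ∩ pattOV o v y) +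
        fibreCount M u₀ (forestEv V ∩ pattOY o v y) (forestEv V ∩ pattVY o v y) +
          fibreCount M u₀ (forestEv V ∩ pattOY o v y) (forestEv V ∩ patt0 o v y) +
      (fibreCount M u₀ (forestEv V ∩ pattVY o v y) (forestEv V ∩ pattOV o v y) +
        fibreCount M u₀ (forestEv V ∩ pattVY o v y) (forestEv V ∩ pattVY o v y) +
          fibreCount M u₀ (forestEv V ∩ pattVY o v y) (forestEv V ∩ patt0 o v y)) +
      (fibreCount M u₀ (forestEv V ∩ patt0 o v y) (forestEv V ∩ pattOV o v y) +
        fibreCount M u₀ (forestEv V ∩ patt0 o v y) (forestEv V ∩ pattVY o v y) +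
          fibreCount M u₀ (forestEv V ∩ patt0 o v y) (forestEv V ∩ patt0 o v y)) := by
  -- the set identities behind the splits
  have l1 : forestEv V ∩ (reachEv o v)ᶜ ∩ reachEv o y = forestEv V ∩ pattOY o v y := by
    ext ω; simp only [pattOY, mem_inter_iff, mem_compl_iff]; tauto
  have l2 : forestEv V ∩ (reachEv o v)ᶜ ∩ (reachEv o y)ᶜ ∩ reachEv v y = forestEv V ∩ pattVY o v y := by
    ext ω; simp only [pattVY, mem_inter_iff, mem_compl_iff]; tauto
  have l3 : forestEv V ∩ (reachEv o v)ᶜ ∩ (reachEv o y)ᶜ ∩ (reachEv v y)ᶜ = forestEv V ∩ patt0 o v y := by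
    ext ω; simp only [patt0, mem_inter_iff, mem_compl_iff]; tauto
  have r1 : forestEv V ∩ (reachEv o y)ᶜ ∩ reachEv o v = forestEv V ∩ pattOV o v y := by
    ext ω; simp only [pattOV, mem_inter_iff, mem_compl_iff]; tauto
  have r2 : forestEv V ∩ (reachEv o y)ᶜ ∩ (reachEv o v)ᶜ ∩ reachEv v y = forestEv V ∩ pattVY o v y := by
    ext ω; simp only [pattVY, mem_inter_iff, mem_compl_iff]; tauto
  have r3 : forestEv V ∩ (reachEv o y)ᶜ ∩ (reachEv o v)ᶜ ∩ (reachEv v y)ᶜ = forestEv V ∩ patt0 o v y := by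
    ext ω; simp only [patt0, mem_inter_iff, mem_compl_iff]; tauto
  -- left event: split by `o ~ y`, then by `v ~ y`
  have hL : ∀ B : Set (BondConfig V), fibreCount M u₀ (forestEv V ∩ (reachEv o v)ᶜ) B =
      fibreCount M u₀ (forestEv V ∩ pattOY o v y) B + fibreCount M u₀ (forestEv V ∩ pattVY o v y) B +
        fibreCount M u₀ (forestEv V ∩ patt0 o v y) B := by
    intro B
    rw [fibreCount_split_left_inter M u₀ _ B (reachEv o y),
      fibreCount_split_left_inter M u₀ (forestEv V ∩ (reachEv o v)ᶜ ∩ (reachEv o y)ᶜ) B (reachEv v y), l1, l2, l3]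
    omega
  -- right event: split by `o ~ v`, then by `v ~ y`
  have hR : ∀ A : Set (BondConfig V), fibreCount M u₀ A (forestEv V ∩ (reachEv o y)ᶜ) =
      fibreCount M u₀ A (forestEv V ∩ pattOV o v y) + fibreCount M u₀ A (forestEv V ∩ pattVY o v y) +
        fibreCount M u₀ A (forestEv V ∩ patt0 o v y) := by
    intro A
    rw [fibreCount_split_right_inter M u₀ A _ (reachEv o v),
      fibreCount_split_right_inter M u₀ A (forestEv V ∩ (reachEv o y)ᶜ ∩ (reachEv o v)ᶜ) (reachEv v y), r1, r2, r3]
    omega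
  rw [hL, hR, hR, hR]

/-- `badR` split by the pattern of the second class (5 terms). [cite: Linusson2011, Prop. 2.6] -/
theorem forest_rest_bad_eq :
    fibreCount M u₀ (forestEv V ∩ patt0 o v y) (forestEv V) =
      fibreCount M u₀ (forestEv V ∩ patt0 o v y) (forestEv V ∩ pattOVY o v y) +
        fibreCount M u₀ (forestEv V ∩ patt0 o v y) (forestEv V ∩ pattOV o v y) +
      (fibreCount M u₀ (forestEv V ∩ patt0 o v y) (forestEv V ∩ pattOY o v y) +
        (fibreCount M u₀ (forestEv V ∩ patt0 o v y) (forestEv V ∩ pattVY o v y) +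
          fibreCount M u₀ (forestEv V ∩ patt0 o v y) (forestEv V ∩ patt0 o v y))) := by
  have b1 : forestEv V ∩ reachEv o v ∩ reachEv o y = forestEv V ∩ pattOVY o v y := by
    ext ω; simp only [pattOVY, mem_inter_iff]; tauto
  have b2 : forestEv V ∩ reachEv o v ∩ (reachEv o y)ᶜ = forestEv V ∩ pattOV o v y := by
    ext ω; simp only [pattOV, mem_inter_iff, mem_compl_iff]; tauto
  have b3 : forestEv V ∩ (reachEv o v)ᶜ ∩ reachEv o y = forestEv V ∩ pattOY o v y := by
    ext ω; simp only [pattOY, mem_inter_iff, mem_compl_iff]; tauto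
  have b4 : forestEv V ∩ (reachEv o v)ᶜ ∩ (reachEv o y)ᶜ ∩ reachEv v y = forestEv V ∩ pattVY o v y := by
    ext ω; simp only [pattVY, mem_inter_iff, mem_compl_iff]; tauto
  have b5 : forestEv V ∩ (reachEv o v)ᶜ ∩ (reachEv o y)ᶜ ∩ (reachEv v y)ᶜ = forestEv V ∩ patt0 o v y := by
    ext ω; simp only [patt0, mem_inter_iff, mem_compl_iff]; tauto
  rw [fibreCount_split_right_inter M u₀ (forestEv V ∩ patt0 o v y) (forestEv V) (reachEv o v),
    fibreCount_split_right_inter M u₀ (forestEv V ∩ patt0 o v y) (forestEv V ∩ reachEv o v) (reachEv o y),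
    fibreCount_split_right_inter M u₀ (forestEv V ∩ patt0 o v y) (forestEv V ∩ (reachEv o v)ᶜ) (reachEv o y),
    fibreCount_split_right_inter M u₀ (forestEv V ∩ patt0 o v y) (forestEv V ∩ (reachEv o v)ᶜ ∩ (reachEv o y)ᶜ) (reachEv v y),
    b1, b2, b3, b4, b5]

/-- **THE PATTERN IDENTITY**: `goodR + N(0;OVY) = badR + N(OV;OY) + N(OV;VY) + N(OY;VY) + N(VY;0) + N(VY;VY)` on every fibre — the node's
margin is `N(0;VY) + N(VY;VY) − D`. [cite: CibulkaHladkyLaCroixWagner2008, Thm. 1 (p. 2)] [cite: Linusson2011, Prop. 2.6] -/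
theorem forest_pattern_identity :
    fibreCount M u₀ (forestEv V ∩ (reachEv o v)ᶜ) (forestEv V ∩ (reachEv o y)ᶜ) +
        fibreCount M u₀ (forestEv V ∩ patt0 o v y) (forestEv V ∩ pattOVY o v y) =
      fibreCount M u₀ (forestEv V ∩ patt0 o v y) (forestEv V) +
        (fibreCount M u₀ (forestEv V ∩ pattOV o v y) (forestEv V ∩ pattOY o v y) +
          fibreCount M u₀ (forestEv V ∩ pattOV o v y) (forestEv V ∩ pattVY o v y) +
            fibreCount M u₀ (forestEv V ∩ pattOY o v y) (forestEv V ∩ pattVY o v y)) +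
        (fibreCount M u₀ (forestEv V ∩ pattVY o v y) (forestEv V ∩ patt0 o v y) +
          fibreCount M u₀ (forestEv V ∩ pattVY o v y) (forestEv V ∩ pattVY o v y)) := by
  rw [forest_rest_good_eq, forest_rest_bad_eq,
    fibreCount_swap M u₀ (forestEv V ∩ pattOY o v y) (forestEv V ∩ pattOV o v y),
    fibreCount_swap M u₀ (forestEv V ∩ pattVY o v y) (forestEv V ∩ pattOV o v y),
    fibreCount_swap M u₀ (forestEv V ∩ pattOY o v y) (forestEv V ∩ patt0 o v y)]
  omega

/-- **Node on the rest fibre ⟺ defect bound**: `badR ≤ goodR ↔ N(0;OVY) ≤ crossings + N(VY;0) + N(VY;VY)`.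
[cite: SempleWelsh2008, Conj. 1.1 (p. 2)] [cite: Linusson2011, Prop. 2.6] -/
theorem forest_rest_node_iff_defectBound :
    fibreCount M u₀ (forestEv V ∩ patt0 o v y) (forestEv V) ≤
        fibreCount M u₀ (forestEv V ∩ (reachEv o v)ᶜ) (forestEv V ∩ (reachEv o y)ᶜ) ↔
      fibreCount M u₀ (forestEv V ∩ patt0 o v y) (forestEv V ∩ pattOVY o v y) ≤
        fibreCount M u₀ (forestEv V ∩ pattOV o v y) (forestEv V ∩ pattOY o v y) +
          fibreCount M u₀ (forestEv V ∩ pattOV o v y) (forestEv V ∩ pattVY o v y) +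
            fibreCount M u₀ (forestEv V ∩ pattOY o v y) (forestEv V ∩ pattVY o v y) +
              fibreCount M u₀ (forestEv V ∩ pattVY o v y) (forestEv V ∩ patt0 o v y) +
                fibreCount M u₀ (forestEv V ∩ pattVY o v y) (forestEv V ∩ pattVY o v y) := by
  have h := forest_pattern_identity M u₀ o v y
  omega

/-- **F3 ⟹ UPPER bound for the node's margin**: `goodR ≤ badR + N(VY;0) + N(VY;VY)` on every fibre.
[cite: CibulkaHladkyLaCroixWagner2008, Thm. 1 (p. 2)] [cite: Linusson2011, Prop. 2.6] -/
theorem forest_rest_margin_le_of_threePoint (h3 : ForestThreePointOn V) (hd : Disjoint u₀ M) :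
    fibreCount M u₀ (forestEv V ∩ (reachEv o v)ᶜ) (forestEv V ∩ (reachEv o y)ᶜ) ≤
      fibreCount M u₀ (forestEv V ∩ patt0 o v y) (forestEv V) +
        (fibreCount M u₀ (forestEv V ∩ pattVY o v y) (forestEv V ∩ patt0 o v y) +
          fibreCount M u₀ (forestEv V ∩ pattVY o v y) (forestEv V ∩ pattVY o v y)) := by
  have h := forest_pattern_identity M u₀ o v y
  have h' := h3 M u₀ hd o v y
  omega

end Identity

/-! ### The defect form implies the node `AdjForestRayleighNoSqOn` -/

section ToNode

variable {M₂ u₀ : BondConfig V} {o v y : V}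

omit [Fintype V] in
/-- The transversal event of `{y, o, v}` is the pattern `0`. [folklore] -/
theorem transvEv_insert_pair_eq_patt0 (hov : o ≠ v) (hoy : o ≠ y) (hvy : v ≠ y) :
    transvEv (insert y ({o, v} : Finset V)) = patt0 o v y := by
  ext ω
  rw [mem_transvEv_insert, mem_transvEv_pair hov]
  simp only [patt0, reachEv, mem_inter_iff, mem_compl_iff, mem_setOf_eq, Finset.mem_insert, Finset.mem_singleton]
  constructor
  · rintro ⟨h1, h2⟩
    refine ⟨⟨h1, fun h => h2 o (Or.inl rfl) hoy h⟩, fun h => h2 v (Or.inr rfl) hvy h⟩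
  · rintro ⟨⟨h1, h2⟩, h3⟩
    refine ⟨h1, fun z hz _ hr => ?_⟩
    rcases hz with rfl | rfl
    · exact h2 hr
    · exact h3 hr

omit [Fintype V] in
/-- The transversal event of `{o, v}` is `o ≁ v`. [folklore] -/
theorem transvEv_pair_eq (hov : o ≠ v) : transvEv ({o, v} : Finset V) = (reachEv o v)ᶜ := by
  ext ω; rw [mem_transvEv_pair hov]; rfl

/-- **Defect bound on the rest fibre ⇒ the node on `(M₂ ∪ {e,f}, u₀)`** (peel `e, f` with g32's injections).
[cite: SempleWelsh2008, Conj. 1.1 (p. 2)] [cite: Linusson2011, Prop. 2.6] -/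
theorem adjForestNoSq_of_defectBound_free (h : ForestDefectBoundOn V) (hd : Disjoint u₀ M₂) (hov : o ≠ v) (hoy : o ≠ y) (hvy : v ≠ y)
    (heM : s(o, v) ∉ M₂) (hfM : s(o, y) ∉ M₂) (heu : s(o, v) ∉ u₀) (hfu : s(o, y) ∉ u₀) :
    fibreCount (insert s(o, v) (insert s(o, y) M₂)) u₀ (forestEv V ∩ {ω | s(o, v) ∈ ω ∧ s(o, y) ∈ ω}) (forestEv V) ≤
      fibreCount (insert s(o, v) (insert s(o, y) M₂)) u₀ (forestEv V ∩ {ω | s(o, v) ∈ ω}) (forestEv V ∩ {ω | s(o, y) ∈ ω}) := by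
  have hrest : fibreCount M₂ u₀ (forestEv V ∩ patt0 o v y) (forestEv V) ≤
      fibreCount M₂ u₀ (forestEv V ∩ (reachEv o v)ᶜ) (forestEv V ∩ (reachEv o y)ᶜ) :=
    (forest_rest_node_iff_defectBound M₂ u₀ o v y).2 (h M₂ u₀ hd o v y hov hoy hvy)
  have h1 := adjForestNoSq_bad_le_transversal (u₀ := u₀) hov hoy hvy heM hfM
  have h2 := adjForestNoSq_transversal_le_good hov hoy hvy heM hfM heu hfu
  rw [transvEv_insert_pair_eq_patt0 hov hoy hvy] at h1
  rw [transvEv_pair_eq hov] at h2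
  exact h1.trans (hrest.trans h2)

/-- **`ForestDefectBoundOn V → AdjForestRayleighNoSqOn V`**: the defect form of the node gives (♣)⁰ on every fibre (degenerate positions of
`e, f` as in `…ForestTransversal`). [cite: SempleWelsh2008, Conj. 1.1 (p. 2); Thm. 4.2 (p. 11)] [cite: CibulkaHladkyLaCroixWagner2008, Thm. 1 (p. 2)] -/
theorem adjForestRayleighNoSqOn_of_defectBound (h : ForestDefectBoundOn V) : AdjForestRayleighNoSqOn V := by
  intro M u₀ hd o v y hvy
  by_cases heM : s(o, v) ∈ M
  swap
  · by_cases heu : s(o, v) ∈ u₀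
    · exact (adjForestNoSq_bad_eq_good_of_pinned hd heu).le
    · rw [adjForestNoSq_bad_eq_zero_of_notMem heM heu]; exact Nat.zero_le _
  by_cases hfM : s(o, y) ∈ M
  swap
  · by_cases hfu : s(o, y) ∈ u₀
    · exact (adjForestNoSq_bad_eq_good_of_pinned' hd hfu).le
    · rw [adjForestNoSq_bad_eq_zero_of_notMem' hfM hfu]; exact Nat.zero_le _
  by_cases hov : o = v
  · rw [fibreCount_eq_zero_of_forall M u₀ _ _ fun ω _ hA _ => hA.1.1 _ hA.2.1 (Sym2.mk_isDiag_iff.2 hov)]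
    exact Nat.zero_le _
  by_cases hoy : o = y
  · rw [fibreCount_eq_zero_of_forall M u₀ _ _ fun ω _ hA _ => hA.1.1 _ hA.2.2 (Sym2.mk_isDiag_iff.2 hoy)]
    exact Nat.zero_le _
  have heu : s(o, v) ∉ u₀ := fun h' => hd.le_bot ⟨h', heM⟩
  have hfu : s(o, y) ∉ u₀ := fun h' => hd.le_bot ⟨h', hfM⟩
  set M₂ : BondConfig V := M \ {s(o, v), s(o, y)} with hM₂
  have hM : M = insert s(o, v) (insert s(o, y) M₂) := by
    ext x
    simp only [hM₂, mem_insert_iff, mem_sdiff, mem_singleton_iff]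
    by_cases hxe : x = s(o, v)
    · subst hxe; tauto
    · by_cases hxf : x = s(o, y)
      · subst hxf; tauto
      · tauto
  have heM₂ : s(o, v) ∉ M₂ := fun h' => h'.2 (Or.inl rfl)
  have hfM₂ : s(o, y) ∉ M₂ := fun h' => h'.2 (Or.inr rfl)
  have hd₂ : Disjoint u₀ M₂ := hd.mono_right sdiff_subset
  rw [hM]
  exact adjForestNoSq_of_defectBound_free h hd₂ hov hoy hvy heM₂ hfM₂ heu hfu

/-- **`ForestDefectBoundPos → AdjForestRayleighNoSqPos`.** [cite: SempleWelsh2008, Conj. 1.1 (p. 2)] -/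
theorem adjForestRayleighNoSqPos_of_defectBoundPos (h : ForestDefectBoundPos) : AdjForestRayleighNoSqPos :=
  fun n => adjForestRayleighNoSqOn_of_defectBound (h n)

end ToNode

/-! ### Symmetry of the defect and of F3 -/

section Symmetry

variable (M u₀ : BondConfig V) (o v y : V)

omit [Fintype V] in
/-- `reachEv` is symmetric. [folklore] -/
private theorem reachEv_comm' (a b : V) : reachEv (V := V) a b = reachEv b a := by
  ext ω; exact ⟨fun h => SimpleGraph.Reachable.symm h, fun h => SimpleGraph.Reachable.symm h⟩

omit [Fintype V] in
/-- Pattern `0` is symmetric under `v ↔ y`. [folklore] -/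
theorem patt0_swap : patt0 o y v = patt0 o v y := by
  ext ω; simp only [patt0, mem_inter_iff, mem_compl_iff, reachEv_comm' y v]; tauto
omit [Fintype V] in
/-- Pattern `OVY` is symmetric under `v ↔ y`. [folklore] -/
theorem pattOVY_swap : pattOVY o y v = pattOVY o v y := by
  ext ω; simp only [pattOVY, mem_inter_iff]; tauto
omit [Fintype V] in
/-- `v ↔ y` exchanges the patterns `OV` and `OY`. [folklore] -/
theorem pattOV_swap : pattOV o y v = pattOY o v y := by
  ext ω; simp only [pattOV, pattOY, mem_inter_iff, mem_compl_iff]; tauto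
omit [Fintype V] in
/-- `v ↔ y` exchanges the patterns `OY` and `OV`. [folklore] -/
theorem pattOY_swap : pattOY o y v = pattOV o v y := by
  ext ω; simp only [pattOV, pattOY, mem_inter_iff, mem_compl_iff]; tauto
omit [Fintype V] in
/-- Pattern `VY` is symmetric under `v ↔ y`. [folklore] -/
theorem pattVY_swap : pattVY o y v = pattVY o v y := by
  ext ω; simp only [pattVY, mem_inter_iff, mem_compl_iff, reachEv_comm' y v]; tauto

/-- **The defect is symmetric under `v ↔ y`**: the F3 sum and `N(0;OVY)` are unchanged (class swap `fibreCount_swap` on the crossing terms).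
[cite: Linusson2011, Prop. 2.6] -/
theorem forest_threePoint_terms_swap :
    fibreCount M u₀ (forestEv V ∩ pattOV o y v) (forestEv V ∩ pattOY o y v) +
        fibreCount M u₀ (forestEv V ∩ pattOV o y v) (forestEv V ∩ pattVY o y v) +
          fibreCount M u₀ (forestEv V ∩ pattOY o y v) (forestEv V ∩ pattVY o y v) =
      fibreCount M u₀ (forestEv V ∩ pattOV o v y) (forestEv V ∩ pattOY o v y) +
        fibreCount M u₀ (forestEv V ∩ pattOV o v y) (forestEv V ∩ pattVY o v y) +
          fibreCount M u₀ (forestEv V ∩ pattOY o v y) (forestEv V ∩ pattVY o v y) ∧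
    fibreCount M u₀ (forestEv V ∩ patt0 o y v) (forestEv V ∩ pattOVY o y v) =
      fibreCount M u₀ (forestEv V ∩ patt0 o v y) (forestEv V ∩ pattOVY o v y) := by
  rw [pattOV_swap o v y, pattOY_swap o v y, pattVY_swap o v y, patt0_swap o v y, pattOVY_swap o v y,
    fibreCount_swap M u₀ (forestEv V ∩ pattOY o v y) (forestEv V ∩ pattOV o v y)]
  refine ⟨?_, rfl⟩
  omega

end Symmetry

end FK
end Summit.CriticalPhenomena.PercolationContinuityZ3.Theorems

end
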